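import Literature.AnabelianGeometry.SemiGraphs.TemperedEscapeLimitLemmas
import Literature.AnabelianGeometry.SemiGraphs.FreeGroupsAndActionsProofs2
import Literature.AnabelianGeometry.SemiGraphs.SemiGraphHeightWalkCritical
import HarnessLib

/-!
# The escape criterion «far fixed vertices + no critical sub-joint» ([SemiAnbd] Thm 3.7 (iii), p. 41)

Mochizuki, *Semi-graphs of anabelioids*, Publ. RIMS **42** (2006) [MochizukiSemiAnbd2006], §3,
Theorem 3.7 (iii), author's manuscript pp. 40–41 [cite: MochizukiSemiAnbd2006, Thm 3.7(iii) pp.40-41]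
("Every compact subgroup of `π₁^temp(𝒢)` is contained in at least one verticial subgroup"), proof
p. 41 l. 30 "Since the semi-graphs `𝔾_j` are all finite" — a proof for FINITE `𝔾` (the cell's
`compactInVerticialAt_of_finiteGraph`); the ∀-countable typing F-1732 has the desk countermodel `𝒢_θ`
of abc-iut-L3-d1 (memo COUNTERMODEL-Thm37iii-infinite.md, four concurring readers; cell programme
REFUTE-F1732, plan/L3/SUBDAG-SemiAnbd-Thm37iii-REFUTE.md).

PROOF-ONLY file (abc-iut-L3-d4, brick R6-level (E); no definitions, no named fact): the MODEL-FREE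
form of the memo's step (2c).  Over any level data `D : VerticialLevelData 𝒢 c` and any height function
`H` on the base vertices whose edge-ends differ by exactly one (a ray, a line, …), an element `g` such that

* (hfar) at every level `g` fixes tree vertices over arbitrarily HIGH base vertices, and
* (hcrit) for every height `n`, at all sufficiently deep levels, NO tree vertex over height `n + 1`
  carries two `g`-fixed edges, one up to height `n + 2` and one down to height `n`
  ("no critical sub-joint" — at `𝒢_θ` this is the abelianisation computation of the memo),

fixes, at deep levels, only vertices of LARGE height (`height_unbounded_of_criticalFree`: geodesics
with fixed endpoints are fixed pointwise, `SemiGraph.nodeMap_eq_self_of_isPath`, and the first-arrival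
lemma `SemiGraph.exists_critical_of_walk`, abc-iut-L3-t6), hence (abc-iut-L3-t5's `escaping_of_height_unbounded`,
abc-iut-L3-t6's `not_compactInVerticialAt_of_escaping` p432161) any compact subgroup containing `g`
falsifies `CompactInVerticialAt 𝒢` and the ∀-countable `CompactInVerticial`
(`not_compactInVerticialAt_of_criticalFree`, `not_compactInVerticial_of_criticalFree`).
NEGATIVE-MODULO form: nothing is asserted about any particular graph; for finite graphs no such `g`
exists.  Nothing here bears on [IUTchIII] Cor. 3.12 (IUT uses finite dual semi-graphs only).
-/

namespace Literature.AnabelianGeometry.SemiGraphs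

namespace ProfiniteSemiGraph

namespace VerticialLevelData

open CategoryTheory

universe v u

variable {𝒢 : ProfiniteSemiGraph.{u}} {c : TemperedPiChart 𝒢} (D : VerticialLevelData.{v} 𝒢 c)

/-- The exact-±1 height step of the base graph pulls back to every level tree along `D.proj j`
(morphisms of semi-graphs are injective on the branches of an edge and respect abutment).
[cite: MochizukiSemiAnbd2006, Thm 3.7(iii) p.41] -/
theorem heightStep_tree (H : 𝒢.graph.Vertex → ℕ)
    (hstep : ∀ (b₁ b₂ : 𝒢.graph.Branch) (v₁ v₂ : 𝒢.graph.Vertex), b₁ ≠ b₂ →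
      𝒢.graph.edgeOf b₁ = 𝒢.graph.edgeOf b₂ → 𝒢.graph.abuts b₁ = some v₁ → 𝒢.graph.abuts b₂ = some v₂ →
      H v₁ + 1 = H v₂ ∨ H v₂ + 1 = H v₁)
    (j : D.J) :
    ∀ (b₁ b₂ : (D.tree j).Branch) (v₁ v₂ : (D.tree j).Vertex), b₁ ≠ b₂ →
      (D.tree j).edgeOf b₁ = (D.tree j).edgeOf b₂ → (D.tree j).abuts b₁ = some v₁ →
      (D.tree j).abuts b₂ = some v₂ →
      H ((D.proj j).vertexMap v₁) + 1 = H ((D.proj j).vertexMap v₂) ∨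
        H ((D.proj j).vertexMap v₂) + 1 = H ((D.proj j).vertexMap v₁) := by
  intro b₁ b₂ v₁ v₂ hne he h₁ h₂
  refine hstep ((D.proj j).branchMap b₁) ((D.proj j).branchMap b₂) _ _ ?_ ?_
    ((D.proj j).abuts_branchMap b₁ v₁ h₁) ((D.proj j).abuts_branchMap b₂ v₂ h₂)
  · exact fun h => hne ((D.proj j).branchMap_injOn b₁ b₂ he h)
  · rw [(D.proj j).edgeOf_branchMap, (D.proj j).edgeOf_branchMap, he]

/-- **Far fixed vertices + no critical sub-joint ⇒ the fixed vertices escape to large height**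
([SemiAnbd] Thm 3.7 (iii) proof p. 41, geodesic bookkeeping; memo (2c) model-free): for every `N`
there is a level at which every `g`-fixed tree vertex lies over a base vertex of height `≥ N`.
[cite: MochizukiSemiAnbd2006, Thm 3.7(iii) p.41] -/
theorem height_unbounded_of_criticalFree (H : 𝒢.graph.Vertex → ℕ)
    (hstep : ∀ (b₁ b₂ : 𝒢.graph.Branch) (v₁ v₂ : 𝒢.graph.Vertex), b₁ ≠ b₂ →
      𝒢.graph.edgeOf b₁ = 𝒢.graph.edgeOf b₂ → 𝒢.graph.abuts b₁ = some v₁ → 𝒢.graph.abuts b₂ = some v₂ →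
      H v₁ + 1 = H v₂ ∨ H v₂ + 1 = H v₁)
    (g : c.G)
    (hfar : ∀ (j : D.J) (n : ℕ), ∃ x : (D.tree j).Vertex,
      n ≤ H ((D.proj j).vertexMap x) ∧ (D.act j g).hom.vertexMap x = x)
    (hcrit : ∀ n : ℕ, ∃ j₀ : D.J, ∀ j, j₀ ≤ j →
      ∀ (v : (D.tree j).Vertex) (b b' : (D.tree j).Branch),
        (D.tree j).abuts b = some v → (D.tree j).abuts b' = some v →
        H ((D.proj j).vertexMap v) = n + 1 →
        (D.act j g).hom.edgeMap ((D.tree j).edgeOf b) = (D.tree j).edgeOf b →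
        (D.act j g).hom.edgeMap ((D.tree j).edgeOf b') = (D.tree j).edgeOf b' →
        (∃ (b₂ : (D.tree j).Branch) (v₂ : (D.tree j).Vertex), b₂ ≠ b ∧
          (D.tree j).edgeOf b₂ = (D.tree j).edgeOf b ∧ (D.tree j).abuts b₂ = some v₂ ∧
          H ((D.proj j).vertexMap v₂) = n + 2) →
        (∃ (b₂ : (D.tree j).Branch) (v₂ : (D.tree j).Vertex), b₂ ≠ b' ∧
          (D.tree j).edgeOf b₂ = (D.tree j).edgeOf b' ∧ (D.tree j).abuts b₂ = some v₂ ∧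
          H ((D.proj j).vertexMap v₂) = n) → False) :
    ∀ N : ℕ, ∃ j : D.J, ∀ y : (D.tree j).Vertex, (D.act j g).hom.vertexMap y = y →
      N ≤ H ((D.proj j).vertexMap y) := by
  classical
  intro N
  choose j₀ hj₀ using hcrit
  -- a level beyond the thresholds of all heights `< N`
  obtain ⟨j, hj⟩ := Finset.exists_le ((Finset.range N).image j₀)
  refine ⟨j, fun y hy => ?_⟩
  by_contra hlt
  push Not at hlt
  set n : ℕ := H ((D.proj j).vertexMap y) with hn
  have hjn : j₀ n ≤ j := hj _ (Finset.mem_image_of_mem j₀ (Finset.mem_range.mpr hlt))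
  -- a far fixed vertex and the fixed geodesic joining it to `y`
  obtain ⟨x, hx, hxfix⟩ := hfar j (n + 2)
  set σ : Aut (D.tree j) := D.act j g with hσ
  have hT := (D.isTree j).isTree
  let p : (D.tree j).subdivision.Path (Sum.inl x) (Sum.inl y) :=
    (hT.connected (Sum.inl x) (Sum.inl y)).some.toPath
  have hxn : SemiGraph.nodeMap σ (Sum.inl x) = Sum.inl x := by simp [hxfix]
  have hyn : SemiGraph.nodeMap σ (Sum.inl y) = Sum.inl y := by simp [hy]
  have hall : ∀ z ∈ p.1.support, SemiGraph.nodeMap σ z = z :=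
    SemiGraph.nodeMap_eq_self_of_isPath hT.isAcyclic σ hxn hyn p.1 p.2
  -- first arrival: a critical sub-joint at height `n + 1`
  obtain ⟨v, b, b', hb, hb', hv, hPb, hPb', hup, hdown⟩ :=
    (D.tree j).exists_critical_of_walk (fun w => H ((D.proj j).vertexMap w))
      (D.heightStep_tree H hstep j) (fun z => SemiGraph.nodeMap σ z = z) n hx le_rfl p.1 hall
  have he : σ.hom.edgeMap ((D.tree j).edgeOf b) = (D.tree j).edgeOf b := by simpa using hPb
  have he' : σ.hom.edgeMap ((D.tree j).edgeOf b') = (D.tree j).edgeOf b' := by simpa using hPb'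
  exact hj₀ n j hjn v b b' hb hb' hv he he' hup hdown

/-- **R6-level ⇒ `hesc`**: under (hfar) and (hcrit), any subgroup containing `g` fixes no compatible
vertex system of the level trees (∘ abc-iut-L3-t5's `escaping_of_height_unbounded`).
[cite: MochizukiSemiAnbd2006, Thm 3.7(iii) p.41] -/
theorem escaping_of_criticalFree (H : 𝒢.graph.Vertex → ℕ)
    (hstep : ∀ (b₁ b₂ : 𝒢.graph.Branch) (v₁ v₂ : 𝒢.graph.Vertex), b₁ ≠ b₂ →
      𝒢.graph.edgeOf b₁ = 𝒢.graph.edgeOf b₂ → 𝒢.graph.abuts b₁ = some v₁ → 𝒢.graph.abuts b₂ = some v₂ →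
      H v₁ + 1 = H v₂ ∨ H v₂ + 1 = H v₁)
    (C : Subgroup c.G) (g : c.G) (hg : g ∈ C)
    (hfar : ∀ (j : D.J) (n : ℕ), ∃ x : (D.tree j).Vertex,
      n ≤ H ((D.proj j).vertexMap x) ∧ (D.act j g).hom.vertexMap x = x)
    (hcrit : ∀ n : ℕ, ∃ j₀ : D.J, ∀ j, j₀ ≤ j →
      ∀ (v : (D.tree j).Vertex) (b b' : (D.tree j).Branch),
        (D.tree j).abuts b = some v → (D.tree j).abuts b' = some v →
        H ((D.proj j).vertexMap v) = n + 1 →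
        (D.act j g).hom.edgeMap ((D.tree j).edgeOf b) = (D.tree j).edgeOf b →
        (D.act j g).hom.edgeMap ((D.tree j).edgeOf b') = (D.tree j).edgeOf b' →
        (∃ (b₂ : (D.tree j).Branch) (v₂ : (D.tree j).Vertex), b₂ ≠ b ∧
          (D.tree j).edgeOf b₂ = (D.tree j).edgeOf b ∧ (D.tree j).abuts b₂ = some v₂ ∧
          H ((D.proj j).vertexMap v₂) = n + 2) →
        (∃ (b₂ : (D.tree j).Branch) (v₂ : (D.tree j).Vertex), b₂ ≠ b' ∧
          (D.tree j).edgeOf b₂ = (D.tree j).edgeOf b' ∧ (D.tree j).abuts b₂ = some v₂ ∧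
          H ((D.proj j).vertexMap v₂) = n) → False) :
    ∀ x : ∀ j, (D.tree j).Vertex, (∀ ⦃i j : D.J⦄ (h : i ≤ j), (D.trans h).vertexMap (x j) = x i) →
      ∃ g' ∈ C, ∃ j, (D.act j g').hom.vertexMap (x j) ≠ x j :=
  D.escaping_of_height_unbounded C g hg H (D.height_unbounded_of_criticalFree H hstep g hfar hcrit)

/-- **R6-level ⇒ `¬ CompactInVerticialAt 𝒢`** for a Thm-3.7 graph with a COMPACT subgroup containing
such a `g` (∘ p432161). NEGATIVE-MODULO form: no such datum is constructed here.
[cite: MochizukiSemiAnbd2006, Thm 3.7(iii) pp.40-41] -/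
theorem not_compactInVerticialAt_of_criticalFree (h37 : 𝒢.Thm37Hypotheses) (H : 𝒢.graph.Vertex → ℕ)
    (hstep : ∀ (b₁ b₂ : 𝒢.graph.Branch) (v₁ v₂ : 𝒢.graph.Vertex), b₁ ≠ b₂ →
      𝒢.graph.edgeOf b₁ = 𝒢.graph.edgeOf b₂ → 𝒢.graph.abuts b₁ = some v₁ → 𝒢.graph.abuts b₂ = some v₂ →
      H v₁ + 1 = H v₂ ∨ H v₂ + 1 = H v₁)
    (C : Subgroup c.G) (hC : IsCompact (C : Set c.G)) (g : c.G) (hg : g ∈ C)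
    (hfar : ∀ (j : D.J) (n : ℕ), ∃ x : (D.tree j).Vertex,
      n ≤ H ((D.proj j).vertexMap x) ∧ (D.act j g).hom.vertexMap x = x)
    (hcrit : ∀ n : ℕ, ∃ j₀ : D.J, ∀ j, j₀ ≤ j →
      ∀ (v : (D.tree j).Vertex) (b b' : (D.tree j).Branch),
        (D.tree j).abuts b = some v → (D.tree j).abuts b' = some v →
        H ((D.proj j).vertexMap v) = n + 1 →
        (D.act j g).hom.edgeMap ((D.tree j).edgeOf b) = (D.tree j).edgeOf b →
        (D.act j g).hom.edgeMap ((D.tree j).edgeOf b') = (D.tree j).edgeOf b' →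
        (∃ (b₂ : (D.tree j).Branch) (v₂ : (D.tree j).Vertex), b₂ ≠ b ∧
          (D.tree j).edgeOf b₂ = (D.tree j).edgeOf b ∧ (D.tree j).abuts b₂ = some v₂ ∧
          H ((D.proj j).vertexMap v₂) = n + 2) →
        (∃ (b₂ : (D.tree j).Branch) (v₂ : (D.tree j).Vertex), b₂ ≠ b' ∧
          (D.tree j).edgeOf b₂ = (D.tree j).edgeOf b' ∧ (D.tree j).abuts b₂ = some v₂ ∧
          H ((D.proj j).vertexMap v₂) = n) → False) :
    ¬ CompactInVerticialAt 𝒢 :=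
  D.not_compactInVerticialAt_of_height_unbounded h37 C hC g hg H
    (D.height_unbounded_of_criticalFree H hstep g hfar hcrit)

/-- … and `¬ CompactInVerticial` (the ∀-countable named fact F-1732). NEGATIVE-MODULO form.
[cite: MochizukiSemiAnbd2006, Thm 3.7(iii) pp.40-41] -/
theorem not_compactInVerticial_of_criticalFree (h37 : 𝒢.Thm37Hypotheses) (H : 𝒢.graph.Vertex → ℕ)
    (hstep : ∀ (b₁ b₂ : 𝒢.graph.Branch) (v₁ v₂ : 𝒢.graph.Vertex), b₁ ≠ b₂ →
      𝒢.graph.edgeOf b₁ = 𝒢.graph.edgeOf b₂ → 𝒢.graph.abuts b₁ = some v₁ → 𝒢.graph.abuts b₂ = some v₂ →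
      H v₁ + 1 = H v₂ ∨ H v₂ + 1 = H v₁)
    (C : Subgroup c.G) (hC : IsCompact (C : Set c.G)) (g : c.G) (hg : g ∈ C)
    (hfar : ∀ (j : D.J) (n : ℕ), ∃ x : (D.tree j).Vertex,
      n ≤ H ((D.proj j).vertexMap x) ∧ (D.act j g).hom.vertexMap x = x)
    (hcrit : ∀ n : ℕ, ∃ j₀ : D.J, ∀ j, j₀ ≤ j →
      ∀ (v : (D.tree j).Vertex) (b b' : (D.tree j).Branch),
        (D.tree j).abuts b = some v → (D.tree j).abuts b' = some v →
        H ((D.proj j).vertexMap v) = n + 1 →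
        (D.act j g).hom.edgeMap ((D.tree j).edgeOf b) = (D.tree j).edgeOf b →
        (D.act j g).hom.edgeMap ((D.tree j).edgeOf b') = (D.tree j).edgeOf b' →
        (∃ (b₂ : (D.tree j).Branch) (v₂ : (D.tree j).Vertex), b₂ ≠ b ∧
          (D.tree j).edgeOf b₂ = (D.tree j).edgeOf b ∧ (D.tree j).abuts b₂ = some v₂ ∧
          H ((D.proj j).vertexMap v₂) = n + 2) →
        (∃ (b₂ : (D.tree j).Branch) (v₂ : (D.tree j).Vertex), b₂ ≠ b' ∧
          (D.tree j).edgeOf b₂ = (D.tree j).edgeOf b' ∧ (D.tree j).abuts b₂ = some v₂ ∧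
          H ((D.proj j).vertexMap v₂) = n) → False) :
    ¬ CompactInVerticial.{u} :=
  D.not_compactInVerticial_of_height_unbounded h37 C hC g hg H
    (D.height_unbounded_of_criticalFree H hstep g hfar hcrit)

end VerticialLevelData

end ProfiniteSemiGraph

end Literature.AnabelianGeometry.SemiGraphs
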